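import Summits.BirchSwinnertonDyer.BirchSwinnertonDyer.Theorems.ThetaPartnerAtTwoMazurTateCongruenceAtTwoROfSymbolLaw
import Summits.BirchSwinnertonDyer.BirchSwinnertonDyer.Theorems.ByReductionTypeAtTwoSupersingularSharpTwo
import Literature.NumberTheory.EllipticCurves.AnalyticRankModularityProofs
import Literature.NumberTheory.EllipticCurves.AnalyticRankOrderProofs
import HarnessLib

/-!
# Crux `MazurTateCongruenceAtTwoTop` (stmt-BirchSwinnertonDyer-25797 = 21416 by name), line `symbol`: THE CONVERSE — the
# crux IMPLIES the depleted-symbol law (SP2) on every theta pair whose partner has analytic rank `0`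
# (lead prover bsd-wall-tp2-p1 g10; `--supports 25797`; closes nothing)

HONEST FRAMING. THEOREMS ONLY; nothing about the truth of the crux or of (SP2) is asserted; BSD is not proved by any of this.

WHAT. `…OfSymbolLaw` proves (SP2) ⟹ `MazurTateCongruenceAtTwoR`. Here: `MazurTateCongruenceAtTwoR` ⟹ (SP2) restricted to
partners `A` of ANALYTIC RANK `0` (`depletedSymbolLaw_of_mazurTateCongruenceAtTwoR`). The restriction is forced by the crux's
own binders: to INSTANTIATE it one needs a Pollack pair of `f_A` at `2`, which the tree supplies (`exists_isPollackPair_two`: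
Sprung's pair at `2` + the `L(A,1) ≠ 0` non-vanishing) only when `L(A,1) ≠ 0`; the cyclotomic variable `γ` comes from
`CyclotomicZp.exists_isTopGenerator_zpExtension`, the integral multiple `G = 2^m ϖ L♭` from `exists_pow_mul_mem_padicInt`,
`S₀ = l.toFinset`. So on the partners the route's `closes` actually uses (`hAr : A.analyticRank = 0`) the registered stub (SP2)
and the crux are EQUAL IN CONTENT: a single instance `(W, A, l, n, a)` violating (SP2) there refutes 21416/25797 as typed.
Mechanism: the layer decomposition (`exists_layer_decomposition`) gives `LHS = ι Y`, `Y = Z + ω_n ρ`,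
`Z = 2^{m+m'+1}Δ_n + ω_n H` in `ℚ₂[X]`; the crux gives `Y = 2^{m+m'+1} q + ω_n r`; Weierstrass division by `ω_n` in `Λ`
(`exists_eq_cyclotomicOmega_mul_add_coe`, `eq_zero_of_cyclotomicOmega_mul_eq_coe`, seat tp2-p1-w2) and polynomial division
by the monic `ω_n` pin `Δ_n` to the image of `ℤ₂[X]`, and the coefficients of `Δ_n` in the basis `(1+X)^s` are the (SP2)
quantities `δ_s` (read off after the substitution `X ↦ X − 1`); every odd `a` is `±5^s (mod 2^{n+2})`
(`exists_sign_mul_cyclotomicGenerator_pow_eq`) and the depleted tables are even and `1`-periodic; the depletion operators at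
different places commute, so the table over `l.toFinset.toList` is the table over `l`.

References: [GreenbergVatsal2000] §1 (8), §3 (13); [Vatsal1999] (1.6), Thm. (1.13); [Pollack2003] Prop. 6.18; [Washington1997] Prop. 7.2.
-/

set_option linter.dupNamespace false
set_option autoImplicit false

noncomputable section

open scoped Classical MatrixGroups ModularForm

open CongruenceSubgroup Polynomial WeierstrassCurve NumberField IsDedekindDomain
  Literature.NumberTheory.EllipticCurves Literature.NumberTheory.EllipticCurves.ModularForms
  Literature.NumberTheory.EllipticCurves.Rank1Residual Literature.NumberTheory.EllipticCurves.GreenbergVatsal2000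
  Literature.NumberTheory.EllipticCurves.Sprung2017
  Summit.BirchSwinnertonDyer.Rank1Residual.Supersingular
  Summit.BirchSwinnertonDyer.BirchSwinnertonDyer.Theorems.ThetaLayerLambdaCongruenceAtTwo

namespace Summit.BirchSwinnertonDyer.BirchSwinnertonDyer.Theorems.MazurTateCongruenceAtTwoR

/-! ## §1. The depletion operators commute; the depleted table does not depend on the order of the places -/

section Commute

variable (W : WeierstrassCurve ℚ)

/-- The one-place depletion operators `P_v(ℓ_v⁻¹[ℓ_v])`, `P_w(ℓ_w⁻¹[ℓ_w])` commute. [cite: EmertonPollackWeston2006, §3 (3.4)–(3.5)] -/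
theorem eulerDepleteTable_comm (v w : HeightOneSpectrum (𝓞 ℚ)) (φ : ℚ → ℚ) :
    eulerDepleteTable W v (eulerDepleteTable W w φ) = eulerDepleteTable W w (eulerDepleteTable W v φ) := by
  funext x
  simp only [eulerDepleteTable, Finset.mul_sum]
  rw [Finset.sum_comm]
  refine Finset.sum_congr rfl fun i _ ↦ Finset.sum_congr rfl fun j _ ↦ ?_
  ring_nf

/-- The depleted table over a list depends only on the underlying multiset: permuted lists give the same table.
[cite: EmertonPollackWeston2006, §3 (3.4)–(3.5)] -/
theorem eulerDepleteTableList_perm {l l' : List (HeightOneSpectrum (𝓞 ℚ))} (h : l.Perm l') (φ : ℚ → ℚ) :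
    eulerDepleteTableList W l φ = eulerDepleteTableList W l' φ := by
  haveI : LeftCommutative (eulerDepleteTable W) := ⟨fun v w φ ↦ eulerDepleteTable_comm W v w φ⟩
  exact h.foldr_eq φ

end Commute

/-! ## §2. Reading off the `(1+X)^s`-coefficients of a layer polynomial -/

section Coeff

/-- If `Σ_{s mod 2ⁿ} c_s (X+1)^s ∈ ℚ₂[X]` is the image of a polynomial over `ℤ₂`, every `c_s` is a `2`-adic integer
(substitute `X ↦ X − 1` and read coefficients). [folklore] -/
theorem norm_le_one_of_layerSum_eq_map {n : ℕ} (c : ZMod (2 ^ n) → ℚ_[2]) {Q : ℤ_[2][X]}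
    (h : (∑ s : ZMod (2 ^ n), C (c s) * (X + 1 : ℚ_[2][X]) ^ s.val) = Q.map (algebraMap ℤ_[2] ℚ_[2]))
    (s : ZMod (2 ^ n)) : ‖c s‖ ≤ 1 := by
  have hcomp := congrArg (fun P : ℚ_[2][X] ↦ (P.comp (X - 1)).coeff s.val) h
  have hl : ((∑ t : ZMod (2 ^ n), C (c t) * (X + 1 : ℚ_[2][X]) ^ t.val).comp (X - 1)).coeff s.val = c s := by
    rw [← Polynomial.coe_compRingHom_apply, map_sum, Polynomial.finsetSum_coeff]
    have e : ∀ t : ZMod (2 ^ n), (Polynomial.compRingHom (X - 1 : ℚ_[2][X]) (C (c t) * (X + 1 : ℚ_[2][X]) ^ t.val)).coeff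
        s.val = if s.val = t.val then c t else 0 := by
      intro t
      rw [Polynomial.coe_compRingHom_apply, Polynomial.mul_comp, Polynomial.C_comp, Polynomial.pow_comp,
        Polynomial.add_comp, Polynomial.X_comp, Polynomial.one_comp, sub_add_cancel, Polynomial.coeff_C_mul_X_pow]
    simp only [e]
    rw [Finset.sum_eq_single s (fun t _ hts ↦ if_neg fun hv ↦ hts (ZMod.val_injective _ hv.symm)) (by simp),
      if_pos rfl]
  have hr : ((Q.map (algebraMap ℤ_[2] ℚ_[2])).comp (X - 1)).coeff s.val =
      algebraMap ℤ_[2] ℚ_[2] ((Q.comp (X - 1)).coeff s.val) := by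
    rw [← Polynomial.coeff_map, Polynomial.map_comp, Polynomial.map_sub, Polynomial.map_X, Polynomial.map_one]
  rw [hl, hr] at hcomp
  rw [hcomp]
  exact PadicInt.norm_le_one _

end Coeff

/-! ## §3. The crux implies (SP2) on rank-`0` partners -/

section Converse

/-- **`MazurTateCongruenceAtTwoR` ⟹ (SP2) for partners of analytic rank `0`.** For a theta pair `(W, A)` as in the crux with,
IN ADDITION, `A.analyticRank = 0` (the clause `hAr` under which the route's `closes` consumes K1), newforms `f, f_A`, period
ratios `ϖ, ϖ_A` and a duplicate-free list `l` of odd places containing the bad places: the crux yields `u ∈ ℤ₂ˣ` with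
`‖ϖΦ^l_W(a/2^{n+2}) − uϖ_AΦ^l_A(a/2^{n+2})‖₂ ≤ 1` for all even `n`, odd `a`. The crux is instantiated at the tree's Pollack pairs
at `2` (`exists_isPollackPair_two`, needs `L(·,1) ≠ 0`), a normalised cyclotomic generator, `S₀ = l.toFinset` and integral
multiples from `exists_pow_mul_mem_padicInt`; then Weierstrass division by `ω_n` reads the layer decomposition backwards.
[cite: GreenbergVatsal2000, §1 p. 9 (display (8)) and §3 (13)] [cite: Washington1997, Prop. 7.2] [cite: Pollack2003, Prop. 6.18] -/
theorem depletedSymbolLaw_rankZero_of_mazurTateCongruenceAtTwoR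
    (hMT : Summit.BirchSwinnertonDyer.BirchSwinnertonDyer.Theses.ThetaPartnerAtTwo.MazurTateCongruenceAtTwoR) :
    ∀ (W : WeierstrassCurve ℚ) [W.IsElliptic] [W.IsGloballyMinimal] (A : WeierstrassCurve ℚ) [A.IsElliptic]
      [A.IsGloballyMinimal], ¬ W.HasCM → W.analyticRank = 0 → GoodSS W 2 → W.frobeniusTrace 2 = 0 → A.HasCM →
      GoodSS A 2 → A.frobeniusTrace 2 = 0 →
      (∃ e : WeierstrassCurve.geomTorsion W (2 : ℤ) ≃+ WeierstrassCurve.geomTorsion A (2 : ℤ),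
        ∀ (σ : Field.absoluteGaloisGroup ℚ) (P : WeierstrassCurve.geomTorsion W (2 : ℤ)), e (σ • P) = σ • e P) →
      A.analyticRank = 0 →
      ∀ [NeZero (W.conductorNorm ℤ)] (f : CuspForm (Gamma0 (W.conductorNorm ℤ)) 2), IsNewformOf W f →
      ∀ (ϖ : ℚ), (ϖ : ℝ) * W.realPeriodRat = plusPeriod f →
      ∀ [NeZero (A.conductorNorm ℤ)] (fA : CuspForm (Gamma0 (A.conductorNorm ℤ)) 2), IsNewformOf A fA →
      ∀ (ϖA : ℚ), (ϖA : ℝ) * A.realPeriodRat = plusPeriod fA →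
      ∀ (l : List (HeightOneSpectrum (𝓞 ℚ))), l.Nodup → (∀ v ∈ l, ((2 : ℕ) : 𝓞 ℚ) ∉ v.asIdeal) →
        (∀ v : HeightOneSpectrum (𝓞 ℚ), ¬ W.HasGoodReductionAt v → v ∈ l) →
        (∀ v : HeightOneSpectrum (𝓞 ℚ), ¬ A.HasGoodReductionAt v → v ∈ l) →
      ∃ u : ℤ_[2]ˣ, ∀ n : ℕ, Even n → ∀ a : ℕ, Odd a →
        ‖((ϖ * eulerDepleteTableList W l (ratPlusSymbol f) ((a : ℚ) / (2 : ℚ) ^ (n + 2)) : ℚ) : ℚ_[2]) -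
            ((u : ℤ_[2]) : ℚ_[2]) *
              ((ϖA * eulerDepleteTableList A l (ratPlusSymbol fA) ((a : ℚ) / (2 : ℚ) ^ (n + 2)) : ℚ) : ℚ_[2])‖ ≤ 1 := by
  intro W _ _ A _ _ hcm hr hss ha hAcm hAss hAa he hAr _ f hf ϖ hϖ _ fA hfA ϖA hϖA l hl hl2 hlW hlA
  -- the data the crux quantifies over: γ, Pollack pairs at `2`, `S₀ = l.toFinset`, integral multiples
  obtain ⟨γ, -, hχ⟩ := CyclotomicZp.exists_isTopGenerator_zpExtension (p := 2)
  have hγ : IsCyclotomicVariable 2 γ := ⟨1, IsOfFinOrder.one, by rw [mul_one]; exact hχ⟩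
  have hLW : W.entireLFunction 1 ≠ 0 := (WeierstrassCurve.analyticRank_eq_zero_iff_holds (W := W)
    (W.hasEntireLFunction_of_cuspCoeff_eq (strictWidthInfty_Gamma0 _) f hf.2)).mp hr
  have hLA : A.entireLFunction 1 ≠ 0 := (WeierstrassCurve.analyticRank_eq_zero_iff_holds (W := A)
    (A.hasEntireLFunction_of_cuspCoeff_eq (strictWidthInfty_Gamma0 _) fA hfA.2)).mp hAr
  obtain ⟨Lplus, Lminus, -, hPP⟩ := exists_isPollackPair_two hf hss.1 ha hLW
  obtain ⟨LplusA, LminusA, -, hPPA⟩ := exists_isPollackPair_two hfA hAss.1 hAa hLA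
  obtain ⟨m, y, hy⟩ := Literature.NumberTheory.QuadraticForms.Dyadic.exists_pow_mul_mem_padicInt ((ϖ : ℚ_[2]))
  obtain ⟨m', yA, hyA⟩ := Literature.NumberTheory.QuadraticForms.Dyadic.exists_pow_mul_mem_padicInt ((ϖA : ℚ_[2]))
  have hK : kobayashiL (1 : ℤˣ) Lplus Lminus = Lminus := if_pos rfl
  have hKA : kobayashiL (1 : ℤˣ) LplusA LminusA = LminusA := if_pos rfl
  have hG : iwasawaToPowerSeries 2 (PowerSeries.C y * Lminus) =
      PowerSeries.C ((2 : ℚ_[2]) ^ m * (ϖ : ℚ_[2])) * iwasawaToPowerSeries 2 (kobayashiL 1 Lplus Lminus) := by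
    rw [hK, map_mul, iwasawaToPowerSeries, PowerSeries.map_C,
      show (algebraMap ℤ_[2] ℚ_[2]) y = (2 : ℚ_[2]) ^ m * (ϖ : ℚ_[2]) from hy]
  have hGA : iwasawaToPowerSeries 2 (PowerSeries.C yA * LminusA) =
      PowerSeries.C ((2 : ℚ_[2]) ^ m' * (ϖA : ℚ_[2])) * iwasawaToPowerSeries 2 (kobayashiL 1 LplusA LminusA) := by
    rw [hKA, map_mul, iwasawaToPowerSeries, PowerSeries.map_C,
      show (algebraMap ℤ_[2] ℚ_[2]) yA = (2 : ℚ_[2]) ^ m' * (ϖA : ℚ_[2]) from hyA]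
  set S₀ : Finset (HeightOneSpectrum (𝓞 ℚ)) := l.toFinset with hS₀
  have hS2 : ∀ v ∈ S₀, ((2 : ℕ) : 𝓞 ℚ) ∉ v.asIdeal := fun v hv ↦ hl2 v (List.mem_toFinset.mp hv)
  have hSW : ∀ v : HeightOneSpectrum (𝓞 ℚ), ¬ W.HasGoodReductionAt v → v ∈ S₀ := fun v hv ↦
    List.mem_toFinset.mpr (hlW v hv)
  have hSA : ∀ v : HeightOneSpectrum (𝓞 ℚ), ¬ A.HasGoodReductionAt v → v ∈ S₀ := fun v hv ↦
    List.mem_toFinset.mpr (hlA v hv)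
  have hperm : S₀.toList.Perm l := List.toFinset_toList hl
  -- the crux, instantiated
  obtain ⟨u, hu⟩ := hMT W A hcm hr hss ha hAcm hAss hAa he γ hγ f hf ϖ hϖ Lplus Lminus hPP fA hfA ϖA hϖA LplusA LminusA
    hPPA S₀ hS2 hSW hSA (PowerSeries.C y * Lminus) m hG (PowerSeries.C yA * LminusA) m' hGA
  refine ⟨u, fun n hn a hodd ↦ ?_⟩
  obtain ⟨q, r, hqr⟩ := hu n hn
  obtain ⟨Y, Z, ρ, H, hLY, hYZ, hZmap⟩ := exists_layer_decomposition W A f fA hPP hPPA hG hGA S₀ hS2 u hn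
  -- `Y = 2^{m+m'+1} q + ω_n r` in `Λ`
  set ωZ : ℤ_[2][X] := (cyclotomicOmega 2 n).map (Int.castRingHom ℤ_[2]) with hωZ
  have hY : Y = PowerSeries.C ((2 : ℤ_[2]) ^ (m + m' + 1)) * q + (ωZ : PowerSeries ℤ_[2]) * r := by
    apply iwasawaToPowerSeries_injective 2
    rw [← hLY, hqr, toIwasawa_eq_coe_map]
  -- Weierstrass division of `q` and polynomial division of `Z` by `ω_n`
  obtain ⟨q₁, q₀, hq₀deg, hq⟩ := exists_eq_cyclotomicOmega_mul_add_coe (p := 2) n q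
  have hωmonic : ωZ.Monic := (monic_cyclotomicOmega 2 n).map _
  have hωnat : ωZ.natDegree = 2 ^ n := by
    rw [hωZ, (monic_cyclotomicOmega 2 n).natDegree_map, cyclotomicOmega, ← C_1, Polynomial.natDegree_sub_C,
      Polynomial.natDegree_pow_X_add_C]
  have hωdeg : ωZ.degree = ((2 ^ n : ℕ) : WithBot ℕ) := by
    rw [Polynomial.degree_eq_natDegree hωmonic.ne_zero, hωnat]
  have hZdiv := Polynomial.modByMonic_add_div Z ωZ
  -- the remainder identity `Z %ₘ ω_n = 2^{m+m'+1} q₀` in `ℤ₂[X]`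
  have hrem : Z %ₘ ωZ - C ((2 : ℤ_[2]) ^ (m + m' + 1)) * q₀ = 0 := by
    have hdeg : (Z %ₘ ωZ - C ((2 : ℤ_[2]) ^ (m + m' + 1)) * q₀).degree < ((2 ^ n : ℕ) : WithBot ℕ) := by
      refine (Polynomial.degree_sub_le _ _).trans_lt (max_lt ?_ ?_)
      · have h1 := Polynomial.degree_modByMonic_lt Z hωmonic
        rwa [hωdeg] at h1
      · rw [Polynomial.degree_C_mul (pow_ne_zero _ two_ne_zero)]
        exact hq₀deg
    refine (eq_zero_of_cyclotomicOmega_mul_eq_coe (p := 2) (n := n)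
      (q := r - ρ + PowerSeries.C ((2 : ℤ_[2]) ^ (m + m' + 1)) * q₁ - ((Z /ₘ ωZ : ℤ_[2][X]) : PowerSeries ℤ_[2]))
      hdeg ?_).2
    have hZΛ := congrArg (fun P : ℤ_[2][X] ↦ (P : PowerSeries ℤ_[2])) hZdiv
    simp only [Polynomial.coe_add, Polynomial.coe_mul] at hZΛ
    rw [Polynomial.coe_sub, Polynomial.coe_mul, Polynomial.coe_C]
    linear_combination -hZΛ + hYZ - hY - PowerSeries.C ((2 : ℤ_[2]) ^ (m + m' + 1)) * hq
  -- `Z = ω_n·(Z / ω_n) + 2^{m+m'+1} q₀` mapped to `ℚ₂[X]`, against the decomposition `Z = 2^{m+m'+1}Δ_n + ω_n H`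
  have hremq : Z %ₘ ωZ = C ((2 : ℤ_[2]) ^ (m + m' + 1)) * q₀ := sub_eq_zero.mp hrem
  have hZK : Z.map (algebraMap ℤ_[2] ℚ_[2]) = ωZ.map (algebraMap ℤ_[2] ℚ_[2]) * (Z /ₘ ωZ).map (algebraMap ℤ_[2] ℚ_[2]) +
      C ((2 : ℚ_[2]) ^ (m + m' + 1)) * q₀.map (algebraMap ℤ_[2] ℚ_[2]) := by
    conv_lhs => rw [← hZdiv, hremq]
    rw [Polynomial.map_add, Polynomial.map_mul, Polynomial.map_mul, Polynomial.map_C, map_pow, map_ofNat]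
    ring
  have hc : C ((2 : ℚ_[2]) * (2 : ℚ_[2]) ^ m * (2 : ℚ_[2]) ^ m') = C ((2 : ℚ_[2]) ^ (m + m' + 1)) := by
    congr 1; ring
  rw [hc] at hZmap
  set Δ : ℚ_[2][X] := ∑ s : ZMod (2 ^ n), C (((ϖ * eulerDepleteTableList W S₀.toList (ratPlusSymbol f) ((((cyclotomicGenerator 2 : ZMod (2 ^ (n + 2))) ^ s.val).val : ℚ) / (2 : ℚ) ^ (n + 2)) : ℚ) :
      ℚ_[2]) - ((u : ℤ_[2]) : ℚ_[2]) * ((ϖA * eulerDepleteTableList A S₀.toList (ratPlusSymbol fA) ((((cyclotomicGenerator 2 : ZMod (2 ^ (n + 2))) ^ s.val).val : ℚ) / (2 : ℚ) ^ (n + 2)) : ℚ) : ℚ_[2])) *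
    (X + 1 : ℚ_[2][X]) ^ s.val with hΔ
  have hD : ωZ.map (algebraMap ℤ_[2] ℚ_[2]) ∣ C ((2 : ℚ_[2]) ^ (m + m' + 1)) * (Δ - q₀.map (algebraMap ℤ_[2] ℚ_[2])) :=
    ⟨(Z /ₘ ωZ).map (algebraMap ℤ_[2] ℚ_[2]) - H, by linear_combination hZK - hZmap⟩
  -- degrees: `deg Δ_n, deg q₀ < 2ⁿ = deg ω_n`
  haveI : NeZero (2 ^ n) := ⟨pow_ne_zero _ two_ne_zero⟩
  have hΔdeg : Δ.degree < ((2 ^ n : ℕ) : WithBot ℕ) := by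
    have hnat : Δ.natDegree ≤ 2 ^ n - 1 := by
      refine Polynomial.natDegree_sum_le_of_forall_le _ _ fun s _ ↦ ?_
      refine (Polynomial.natDegree_C_mul_le _ _).trans ?_
      refine (Polynomial.natDegree_pow_le).trans ?_
      have h1 : (X + 1 : ℚ_[2][X]).natDegree = 1 := by rw [← C_1, Polynomial.natDegree_X_add_C]
      rw [h1, mul_one]
      have := ZMod.val_lt s
      omega
    have h1 : 1 ≤ 2 ^ n := Nat.one_le_two_pow
    exact (Polynomial.degree_le_natDegree).trans_lt (by exact_mod_cast (show Δ.natDegree < 2 ^ n by omega))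
  have hq₀K : (q₀.map (algebraMap ℤ_[2] ℚ_[2])).degree < ((2 ^ n : ℕ) : WithBot ℕ) :=
    (Polynomial.degree_map_le).trans_lt hq₀deg
  have hωKdeg : (ωZ.map (algebraMap ℤ_[2] ℚ_[2])).degree = ((2 ^ n : ℕ) : WithBot ℕ) := by
    rw [Polynomial.Monic.degree_map hωmonic, hωdeg]
  have hdeg : (C ((2 : ℚ_[2]) ^ (m + m' + 1)) * (Δ - q₀.map (algebraMap ℤ_[2] ℚ_[2]))).degree <
      (ωZ.map (algebraMap ℤ_[2] ℚ_[2])).degree := by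
    rw [hωKdeg, Polynomial.degree_C_mul (pow_ne_zero _ two_ne_zero)]
    exact (Polynomial.degree_sub_le _ _).trans_lt (max_lt hΔdeg hq₀K)
  have h0 := Polynomial.eq_zero_of_dvd_of_degree_lt hD hdeg
  have hΔeq : Δ = q₀.map (algebraMap ℤ_[2] ℚ_[2]) := by
    rcases mul_eq_zero.mp h0 with h | h
    · exact absurd (Polynomial.C_eq_zero.mp h) (pow_ne_zero _ two_ne_zero)
    · exact sub_eq_zero.mp h
  -- so every `δ_s` (over the list `S₀.toList`) is a `2`-adic integer
  have hint := norm_le_one_of_layerSum_eq_map _ hΔeq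
  -- the tables over `S₀.toList` are the tables over `l`
  have hperm : S₀.toList.Perm l := List.toFinset_toList hl
  simp only [eulerDepleteTableList_perm W hperm, eulerDepleteTableList_perm A hperm] at hint
  -- the odd numerator `a` is `± 5^F (mod 2^{n+2})`
  have ha2 : ¬ 2 ∣ a := fun h ↦ (Nat.not_even_iff_odd.mpr hodd) (even_iff_two_dvd.mpr h)
  obtain ⟨ω, hω, haω⟩ := exists_sign_mul_cyclotomicGenerator_pow_eq ha2 n
  set F : ℕ := (PadicInt.toZModPow n (frobeniusExponent 2 (a : ℤ_[2]))).val with hF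
  set s₀ : ZMod (2 ^ n) := (F : ZMod (2 ^ n)) with hs₀
  have hs₀v : s₀.val = F % 2 ^ n := ZMod.val_natCast (2 ^ n) F
  haveI : Fact (1 < 2 ^ (n + 2)) := ⟨Nat.one_lt_two_pow (by omega)⟩
  have hxa : ∀ ψ : ℚ → ℚ, (∀ x, ψ (-x) = ψ x) → (∀ (x : ℚ) (z : ℤ), ψ (x + z) = ψ x) →
      ψ ((a : ℚ) / (2 : ℚ) ^ (n + 2)) =
        ψ ((((cyclotomicGenerator 2 : ZMod (2 ^ (n + 2))) ^ s₀.val).val : ℚ) / (2 : ℚ) ^ (n + 2)) := by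
    intro ψ hneg hper
    have h := apply_mul_cyclotomicGenerator_pow_val_div ψ hneg hper hω haω 0
    rw [pow_zero, ZMod.val_one, zero_add, Nat.cast_one, ← mul_div_assoc, mul_one] at h
    rw [h, hs₀v, ← cyclotomicGenerator_two_pow_eq_pow_mod]
  rw [hxa _ (eulerDepleteTableList_neg W l (ratPlusSymbol_neg f)) (eulerDepleteTableList_add_intCast' W l
      (ratPlusSymbol_add_intCast_eq f)),
    hxa _ (eulerDepleteTableList_neg A l (ratPlusSymbol_neg fA)) (eulerDepleteTableList_add_intCast' A l
      (ratPlusSymbol_add_intCast_eq fA))]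
  exact hint s₀

end Converse

end Summit.BirchSwinnertonDyer.BirchSwinnertonDyer.Theorems.MazurTateCongruenceAtTwoR

end
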